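import Literature.MathematicalPhysics.QuantumFieldTheory.Balaban1983to89.B12Eq311PlaquetteBounds

/-!
# `Balaban1983to89.B12Eq311LatticeBounds` — [Balaban1987RG1] (3.11) p. 272 by the route [Balaban1985RegularSpaces] (1.43)–(1.54):
# file 3 of 4 — LATTICE BOUNDS: the letters and their COVARIANT DIFFERENCES (the «∇^ξ_U𝐀» dependence of 𝐅), the plaquette function
# of `U′`, and the three terms of the decomposition of 𝐅, direction by direction

statement-level skeleton of published theorems with citation tags; proofs where landed; nothing here is a claim about the Yang–Mills mass gap

Cell `lit-balaban`, unit `lit-balaban-p07` (Phase-2 proof seat p07 gen 7); SKELETON row `B12.Eq3.10-3.12`; HOME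
`run/shared/lean/pub/lit-balaban/`.  See the header of `B12Eq311CurrentExpansion` (file 1) for the printed texts, the carriers and the
HONEST SCOPE; this file is theorems only.  Standing hypotheses (binders): `‖U(b)^{±1}‖ ≤ ρ`, `‖A(b)‖ ≤ a`, `‖(D¹_U A)‖ ≤ ξg`
(`= ξ²|∇^ξ_U A|`-bound), `‖U(∂p) − 1‖ ≤ ε`, `‖πX‖ ≤ Cπ‖X‖`, `π ∘ Ad(U(b)⁻¹) = Ad(U(b)⁻¹) ∘ π`.

THIS FILE.  §1 `R_inv_near_sub` (`R(U(b))⁻¹f(b₋) − f(b₊) = −R(U(b))⁻¹(D¹_Uf)(b)`), letter sizes `norm_ℓ₁_le` … `norm_ℓ₄_le`,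
`size_letters_le` (`≤ ξs̄`, `s̄ = 2(1 + ρ²)a`), `size_R_letters_le`, `norm_R_inv_near_sub_le`, **`sum_norm_R_letters_sub_le`** (the
letters of `p_{κν}(y)` transported along `⟨y, y+e_γ⟩` differ from those of `p_{κν}(y+e_γ)` by `≤ ξ²(6ρ² + 2)g` in total —
`B9Eq369Product.R_far_eq`; no commutation of shifts is used).  §2 `norm_curl_le`, `letterSize_le`, **`norm_plaq_prodCfg_sub_one_le`**
(`‖U′(∂p) − 1‖ ≤ ξ²Π₁`, `Π₁ = 2g + ½s̄²e^{ξs̄} + e^{ξs̄}ε/ξ²`; [14] (1.26)/(1.43)), `prodCfg_bound`, **`norm_Gπ_prodCfg_le`**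
(`‖ξ⁻²π Im U′(∂p)‖ ≤ Cπ·½(1 + (e^{ξa}ρ)⁴)·Π₁`), **`norm_termI_dir_le`** (change of transport, [14] (1.44)–(1.45):
`B9Eq370Expansion.norm_covDstar_prodCfg_sub_le`), **`norm_covDstar_q₂_le`** (the second-order term under `D¹*_{U,γ}`:
`≤ Cπξ³(1 + ρ²)(3ρ² + 1)s̄g` — [14] (1.49)–(1.53)), `norm_r₃_plaq_le`, **`norm_covDstar_r₃_le`**.
-/

noncomputable section

open NormedSpace Complex

namespace Literature.MathematicalPhysics.QuantumFieldTheory.Balaban1983to89.B12Eq311LatticeBounds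

open Literature.MathematicalPhysics.QuantumFieldTheory.Balaban1983to89
open Literature.MathematicalPhysics.QuantumFieldTheory.Balaban1983to89.Beta.TransportVertices
open Literature.MathematicalPhysics.QuantumFieldTheory.Balaban1983to89.Beta.AdjointTransportJets
open Literature.MathematicalPhysics.QuantumFieldTheory.Balaban1983to89.B9Eq37Insertion
open Literature.MathematicalPhysics.QuantumFieldTheory.Balaban1983to89.B9Eq39Adjoint
open Literature.MathematicalPhysics.QuantumFieldTheory.Balaban1983to89.B9Eq369Small Literature.MathematicalPhysics.QuantumFieldTheory.Balaban1983to89.B9Eq369Product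
open Literature.MathematicalPhysics.QuantumFieldTheory.Balaban1983to89.B9Eq370Expansion
open Literature.MathematicalPhysics.QuantumFieldTheory.Balaban1983to89.B9TorusCalculus
open Literature.MathematicalPhysics.QuantumFieldTheory.Balaban1983to89.B12Eq311CurrentExpansion
open Literature.MathematicalPhysics.QuantumFieldTheory.Balaban1983to89.B12Eq311PlaquetteBounds

/-! ## §1  The letters on the lattice: sizes and covariant differences -/

section LatticeBounds

variable {𝔸 : Type*} [NormedRing 𝔸] [NormedAlgebra ℂ 𝔸] [CompleteSpace 𝔸] {S : Type*} {ι : Type*}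
variable (T : ι → Equiv.Perm S) (U : ι → S → 𝔸ˣ)
variable {ρ a g ε ξ : ℝ} {A : ι → S → 𝔸}

omit [NormedAlgebra ℂ 𝔸] [CompleteSpace 𝔸] in
/-- `R(U(b))⁻¹f(b₋) − f(b₊) = −R(U(b))⁻¹(D¹_U f)(b)`: a backward transport of a near value differs from the far value by a covariant
derivative ((3.3) read as `R(U(b))f(b₊) = f(b₋) + η(D^η_U f)(b)`). [cite: Balaban1985BackgroundPropagators, (3.3) p.390] -/
theorem R_inv_near_sub (γ : ι) (f : S → 𝔸) (y : S) :
    R (U γ y)⁻¹ (f y) - f (T γ y) = -R (U γ y)⁻¹ (covD T U γ f y) := by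
  rw [covD, R_sub, R_inv_R]; abel

omit [CompleteSpace 𝔸] in
/-- `‖l₁‖ ≤ ξa` ([14] (1.41): `|A| < α₂(Lʲη)⁻¹`). [cite: Balaban1985RegularSpaces, (1.41) p.83] -/
theorem norm_ℓ₁_le (hξ : 0 ≤ ξ) (hA : ∀ μ x, ‖A μ x‖ ≤ a) (κ ν : ι) (y : S) : ‖ℓ₁ ξ A κ ν y‖ ≤ ξ * a := by
  rw [ℓ₁, norm_Iη_smul hξ]; exact mul_le_mul_of_nonneg_left (hA _ _) hξ

omit [CompleteSpace 𝔸] in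
/-- `‖l₂‖ ≤ ρ²ξa`. [cite: Balaban1985RegularSpaces, (1.41) p.83] -/
theorem norm_ℓ₂_le (hξ : 0 ≤ ξ) (hU : ∀ μ x, ‖(U μ x : 𝔸)‖ ≤ ρ ∧ ‖(((U μ x)⁻¹ : 𝔸ˣ) : 𝔸)‖ ≤ ρ)
    (hA : ∀ μ x, ‖A μ x‖ ≤ a) (κ ν : ι) (y : S) : ‖ℓ₂ T U ξ A κ ν y‖ ≤ ρ ^ 2 * (ξ * a) := by
  rw [ℓ₂]
  refine (norm_R_le_rho (hU _ _).1 (hU _ _).2 _).trans (mul_le_mul_of_nonneg_left ?_ (sq_nonneg ρ))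
  rw [norm_Iη_smul hξ]; exact mul_le_mul_of_nonneg_left (hA _ _) hξ

omit [CompleteSpace 𝔸] in
/-- `‖l₃‖ ≤ ρ²ξa`. [cite: Balaban1985RegularSpaces, (1.41) p.83] -/
theorem norm_ℓ₃_le (hξ : 0 ≤ ξ) (hU : ∀ μ x, ‖(U μ x : 𝔸)‖ ≤ ρ ∧ ‖(((U μ x)⁻¹ : 𝔸ˣ) : 𝔸)‖ ≤ ρ)
    (hA : ∀ μ x, ‖A μ x‖ ≤ a) (κ ν : ι) (y : S) : ‖ℓ₃ T U ξ A κ ν y‖ ≤ ρ ^ 2 * (ξ * a) := by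
  rw [ℓ₃, norm_neg]
  refine (norm_R_le_rho (hU _ _).1 (hU _ _).2 _).trans (mul_le_mul_of_nonneg_left ?_ (sq_nonneg ρ))
  rw [norm_Iη_smul hξ]; exact mul_le_mul_of_nonneg_left (hA _ _) hξ

omit [CompleteSpace 𝔸] in
/-- `‖l₄‖ ≤ ξa`. [cite: Balaban1985RegularSpaces, (1.41) p.83] -/
theorem norm_ℓ₄_le (hξ : 0 ≤ ξ) (hA : ∀ μ x, ‖A μ x‖ ≤ a) (κ ν : ι) (y : S) : ‖ℓ₄ ξ A κ ν y‖ ≤ ξ * a := by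
  rw [ℓ₄, norm_neg, norm_Iη_smul hξ]; exact mul_le_mul_of_nonneg_left (hA _ _) hξ

omit [CompleteSpace 𝔸] in
/-- The size of the four letters: `size l ≤ ξ·s̄`, `s̄ = 2(1 + ρ²)a`. [cite: Balaban1985RegularSpaces, (1.41) p.83] -/
theorem size_letters_le (hξ : 0 ≤ ξ) (hU : ∀ μ x, ‖(U μ x : 𝔸)‖ ≤ ρ ∧ ‖(((U μ x)⁻¹ : 𝔸ˣ) : 𝔸)‖ ≤ ρ)
    (hA : ∀ μ x, ‖A μ x‖ ≤ a) (κ ν : ι) (y : S) :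
    size [ℓ₁ ξ A κ ν y, ℓ₂ T U ξ A κ ν y, ℓ₃ T U ξ A κ ν y, ℓ₄ ξ A κ ν y] ≤ ξ * (2 * (1 + ρ ^ 2) * a) := by
  simp only [size_cons, size_nil, add_zero]
  have h1 := norm_ℓ₁_le hξ hA κ ν y
  have h2 := norm_ℓ₂_le T U hξ hU hA κ ν y
  have h3 := norm_ℓ₃_le T U hξ hU hA κ ν y
  have h4 := norm_ℓ₄_le hξ hA κ ν y
  nlinarith

omit [CompleteSpace 𝔸] in
/-- … and of their transports by a bond variable: `size R(W)l ≤ ρ²ξ·s̄`. [cite: Balaban1985RegularSpaces, (1.41) p.83] -/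
theorem size_R_letters_le (hξ : 0 ≤ ξ) (hU : ∀ μ x, ‖(U μ x : 𝔸)‖ ≤ ρ ∧ ‖(((U μ x)⁻¹ : 𝔸ˣ) : 𝔸)‖ ≤ ρ)
    (hA : ∀ μ x, ‖A μ x‖ ≤ a) (γ κ ν : ι) (z y : S) :
    size [R (U γ z)⁻¹ (ℓ₁ ξ A κ ν y), R (U γ z)⁻¹ (ℓ₂ T U ξ A κ ν y), R (U γ z)⁻¹ (ℓ₃ T U ξ A κ ν y),
        R (U γ z)⁻¹ (ℓ₄ ξ A κ ν y)] ≤ ρ ^ 2 * (ξ * (2 * (1 + ρ ^ 2) * a)) := by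
  simp only [size_cons, size_nil, add_zero]
  have h1 := (norm_R_inv_le_rho (hU γ z).1 (hU γ z).2 _).trans (mul_le_mul_of_nonneg_left (norm_ℓ₁_le hξ hA κ ν y) (sq_nonneg ρ))
  have h2 := (norm_R_inv_le_rho (hU γ z).1 (hU γ z).2 _).trans
    (mul_le_mul_of_nonneg_left (norm_ℓ₂_le T U hξ hU hA κ ν y) (sq_nonneg ρ))
  have h3 := (norm_R_inv_le_rho (hU γ z).1 (hU γ z).2 _).trans
    (mul_le_mul_of_nonneg_left (norm_ℓ₃_le T U hξ hU hA κ ν y) (sq_nonneg ρ))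
  have h4 := (norm_R_inv_le_rho (hU γ z).1 (hU γ z).2 _).trans (mul_le_mul_of_nonneg_left (norm_ℓ₄_le hξ hA κ ν y) (sq_nonneg ρ))
  nlinarith

omit [NormedAlgebra ℂ 𝔸] [CompleteSpace 𝔸] in
/-- A near value under backward transport: `‖R(U_γ(y))⁻¹f(y) − f(y+e_γ)‖ ≤ ρ²‖(D¹_{U,γ}f)(y)‖`. [cite: Balaban1985BackgroundPropagators, (3.3) p.390] -/
theorem norm_R_inv_near_sub_le (hU : ∀ μ x, ‖(U μ x : 𝔸)‖ ≤ ρ ∧ ‖(((U μ x)⁻¹ : 𝔸ˣ) : 𝔸)‖ ≤ ρ) (γ : ι) (f : S → 𝔸)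
    (y : S) : ‖R (U γ y)⁻¹ (f y) - f (T γ y)‖ ≤ ρ ^ 2 * ‖covD T U γ f y‖ := by
  rw [R_inv_near_sub, norm_neg]; exact norm_R_inv_le_rho (hU _ _).1 (hU _ _).2 _

omit [CompleteSpace 𝔸] in
/-- **THE COVARIANT DIFFERENCES OF THE LETTERS** («depending on … ∇^ξ_U𝐀»): transporting the letters of `p_{κν}(y)` back along
`⟨y, y+e_γ⟩` and comparing with the letters of `p_{κν}(y+e_γ)` costs `≤ ξ²(6ρ² + 2)g` in total, `g = sup|∇^ξ_U A|`
(`‖D¹_U A‖ ≤ ξg`); no commutation of shifts is used ([14] (1.52): the derivative of a product of letters). [cite: Balaban1985RegularSpaces, (1.52) p.85] -/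
theorem sum_norm_R_letters_sub_le (hξ : 0 ≤ ξ) (hU : ∀ μ x, ‖(U μ x : 𝔸)‖ ≤ ρ ∧ ‖(((U μ x)⁻¹ : 𝔸ˣ) : 𝔸)‖ ≤ ρ)
    (hDA : ∀ κ ν y, ‖covD T U κ (A ν) y‖ ≤ ξ * g) (γ κ ν : ι) (y : S) :
    ‖R (U γ y)⁻¹ (ℓ₁ ξ A κ ν y) - ℓ₁ ξ A κ ν (T γ y)‖ + ‖R (U γ y)⁻¹ (ℓ₂ T U ξ A κ ν y) - ℓ₂ T U ξ A κ ν (T γ y)‖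
      + ‖R (U γ y)⁻¹ (ℓ₃ T U ξ A κ ν y) - ℓ₃ T U ξ A κ ν (T γ y)‖ + ‖R (U γ y)⁻¹ (ℓ₄ ξ A κ ν y) - ℓ₄ ξ A κ ν (T γ y)‖
      ≤ ξ ^ 2 * ((6 * ρ ^ 2 + 2) * g) := by
  have hρ2 : 0 ≤ ρ ^ 2 := sq_nonneg ρ
  have hg : 0 ≤ ξ * g := (norm_nonneg _).trans (hDA κ ν y)
  -- letter 1
  have d1 : ‖R (U γ y)⁻¹ (ℓ₁ ξ A κ ν y) - ℓ₁ ξ A κ ν (T γ y)‖ ≤ ξ * (ρ ^ 2 * (ξ * g)) := by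
    rw [ℓ₁, ℓ₁, R_smul, ← smul_sub, norm_Iη_smul hξ]
    exact mul_le_mul_of_nonneg_left ((norm_R_inv_near_sub_le T U hU γ (A κ) y).trans
      (mul_le_mul_of_nonneg_left (hDA _ _ _) hρ2)) hξ
  -- letter 2
  have d2 : ‖R (U γ y)⁻¹ (ℓ₂ T U ξ A κ ν y) - ℓ₂ T U ξ A κ ν (T γ y)‖ ≤ ξ * ((2 * ρ ^ 2 + 1) * (ξ * g)) := by
    have e : R (U γ y)⁻¹ (ℓ₂ T U ξ A κ ν y) - ℓ₂ T U ξ A κ ν (T γ y)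
        = (I * ξ : ℂ) • ((R (U γ y)⁻¹ (A ν y) - A ν (T γ y))
            + (R (U γ y)⁻¹ (covD T U κ (A ν) y) - covD T U κ (A ν) (T γ y))) := by
      rw [ℓ₂, ℓ₂, R_smul, R_smul, R_smul, R_far_eq, R_far_eq, R_add]
      simp only [smul_add, smul_sub]
      abel
    rw [e, norm_Iη_smul hξ]
    refine mul_le_mul_of_nonneg_left ((norm_add_le _ _).trans ?_) hξ
    have t1 := (norm_R_inv_near_sub_le T U hU γ (A ν) y).trans (mul_le_mul_of_nonneg_left (hDA _ _ _) hρ2)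
    have t2 : ‖R (U γ y)⁻¹ (covD T U κ (A ν) y) - covD T U κ (A ν) (T γ y)‖ ≤ ρ ^ 2 * (ξ * g) + ξ * g :=
      norm_sub_le_of_le ((norm_R_inv_le_rho (hU _ _).1 (hU _ _).2 _).trans (mul_le_mul_of_nonneg_left (hDA _ _ _) hρ2))
        (hDA _ _ _)
    linarith
  -- letter 3
  have d3 : ‖R (U γ y)⁻¹ (ℓ₃ T U ξ A κ ν y) - ℓ₃ T U ξ A κ ν (T γ y)‖ ≤ ξ * ((2 * ρ ^ 2 + 1) * (ξ * g)) := by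
    have e : R (U γ y)⁻¹ (ℓ₃ T U ξ A κ ν y) - ℓ₃ T U ξ A κ ν (T γ y)
        = -((I * ξ : ℂ) • ((R (U γ y)⁻¹ (A κ y) - A κ (T γ y))
            + (R (U γ y)⁻¹ (covD T U ν (A κ) y) - covD T U ν (A κ) (T γ y)))) := by
      rw [ℓ₃, ℓ₃, R_neg, R_smul, R_smul, R_smul, R_far_eq, R_far_eq, R_add]
      simp only [smul_add, smul_sub]
      abel
    rw [e, norm_neg, norm_Iη_smul hξ]
    refine mul_le_mul_of_nonneg_left ((norm_add_le _ _).trans ?_) hξ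
    have t1 := (norm_R_inv_near_sub_le T U hU γ (A κ) y).trans (mul_le_mul_of_nonneg_left (hDA _ _ _) hρ2)
    have t2 : ‖R (U γ y)⁻¹ (covD T U ν (A κ) y) - covD T U ν (A κ) (T γ y)‖ ≤ ρ ^ 2 * (ξ * g) + ξ * g :=
      norm_sub_le_of_le ((norm_R_inv_le_rho (hU _ _).1 (hU _ _).2 _).trans (mul_le_mul_of_nonneg_left (hDA _ _ _) hρ2))
        (hDA _ _ _)
    linarith
  -- letter 4
  have d4 : ‖R (U γ y)⁻¹ (ℓ₄ ξ A κ ν y) - ℓ₄ ξ A κ ν (T γ y)‖ ≤ ξ * (ρ ^ 2 * (ξ * g)) := by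
    have e : R (U γ y)⁻¹ (ℓ₄ ξ A κ ν y) - ℓ₄ ξ A κ ν (T γ y) = -((I * ξ : ℂ) • (R (U γ y)⁻¹ (A ν y) - A ν (T γ y))) := by
      rw [ℓ₄, ℓ₄, R_neg, R_smul, smul_sub]; abel
    rw [e, norm_neg, norm_Iη_smul hξ]
    exact mul_le_mul_of_nonneg_left ((norm_R_inv_near_sub_le T U hU γ (A ν) y).trans
      (mul_le_mul_of_nonneg_left (hDA _ _ _) hρ2)) hξ
  nlinarith

end LatticeBounds

/-! ## §2  The plaquette function of `U′` and the three terms, direction by direction -/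

section Terms

variable {𝔸 : Type*} [NormedRing 𝔸] [NormedAlgebra ℂ 𝔸] [CompleteSpace 𝔸] {S : Type*} {ι : Type*}
variable (T : ι → Equiv.Perm S) (U : ι → S → 𝔸ˣ)
variable {ρ a g ε ξ Cπ : ℝ} {A : ι → S → 𝔸} {π : 𝔸 →ₗ[ℂ] 𝔸}

omit [NormedAlgebra ℂ 𝔸] [CompleteSpace 𝔸] in
/-- `‖(D¹_U A)(p)‖ ≤ 2ξg` (the curl (3.4) from its two covariant derivatives). [cite: Balaban1985BackgroundPropagators, (3.4) p.391] -/
theorem norm_curl_le (hDA : ∀ κ ν y, ‖covD T U κ (A ν) y‖ ≤ ξ * g) (κ ν : ι) (y : S) :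
    ‖curl T U A κ ν y‖ ≤ 2 * (ξ * g) := by
  rw [curl]; exact (norm_sub_le _ _).trans (by linarith [hDA κ ν y, hDA ν κ y])

omit [NormedAlgebra ℂ 𝔸] [CompleteSpace 𝔸] in
/-- `letterSize ≤ s̄ = 2(1 + ρ²)a`. [cite: Balaban1985RegularSpaces, (1.41) p.83] -/
theorem letterSize_le (hU : ∀ μ x, ‖(U μ x : 𝔸)‖ ≤ ρ ∧ ‖(((U μ x)⁻¹ : 𝔸ˣ) : 𝔸)‖ ≤ ρ) (hA : ∀ μ x, ‖A μ x‖ ≤ a)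
    (κ ν : ι) (y : S) : letterSize T U A κ ν y ≤ 2 * (1 + ρ ^ 2) * a := by
  unfold letterSize
  have h2 := (norm_R_le_rho (hU κ y).1 (hU κ y).2 (A ν (T κ y))).trans (mul_le_mul_of_nonneg_left (hA _ _) (sq_nonneg ρ))
  have h3 := (norm_R_le_rho (hU ν y).1 (hU ν y).2 (A κ (T ν y))).trans (mul_le_mul_of_nonneg_left (hA _ _) (sq_nonneg ρ))
  linarith [hA κ y, hA ν y]

/-- **THE PLAQUETTE DEVIATION OF `U′ = e^{iξA}U`**: `‖U′(∂p) − 1‖ ≤ ξ²·Π₁`, `Π₁ = 2g + ½s̄²e^{ξs̄} + e^{ξs̄}·(ε/ξ²)`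
(`B9Eq369Product.norm_plaqU_prodCfg_sub_one_le` with the letters bounded). [folklore] [cite: Balaban1985RegularSpaces, (1.26) p.79] -/
theorem norm_plaq_prodCfg_sub_one_le (hξ : 0 < ξ)
    (hU : ∀ μ x, ‖(U μ x : 𝔸)‖ ≤ ρ ∧ ‖(((U μ x)⁻¹ : 𝔸ˣ) : 𝔸)‖ ≤ ρ) (hA : ∀ μ x, ‖A μ x‖ ≤ a)
    (hDA : ∀ κ ν y, ‖covD T U κ (A ν) y‖ ≤ ξ * g) (κ ν : ι) (y : S) (hP : ‖(plaqU T U κ ν y : 𝔸) - 1‖ ≤ ε) :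
    ‖(plaqU T (prodCfg U ξ A) κ ν y : 𝔸) - 1‖
      ≤ ξ ^ 2 * (2 * g + 1 / 2 * (2 * (1 + ρ ^ 2) * a) ^ 2 * Real.exp (ξ * (2 * (1 + ρ ^ 2) * a))
          + Real.exp (ξ * (2 * (1 + ρ ^ 2) * a)) * (ε / ξ ^ 2)) := by
  have hLS := letterSize_le T U hU hA κ ν y
  have hLS0 : 0 ≤ letterSize T U A κ ν y := letterSize_nonneg T U A κ ν y
  have hex : Real.exp (ξ * letterSize T U A κ ν y) ≤ Real.exp (ξ * (2 * (1 + ρ ^ 2) * a)) :=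
    Real.exp_le_exp.mpr (mul_le_mul_of_nonneg_left hLS hξ.le)
  have hε : 0 ≤ ε := (norm_nonneg _).trans hP
  refine (norm_plaqU_prodCfg_sub_one_le T U hξ.le A κ ν y).trans ?_
  have e1 : ξ * ‖curl T U A κ ν y‖ ≤ ξ ^ 2 * (2 * g) := by
    have := norm_curl_le T U hDA κ ν y; nlinarith
  have e2 : 1 / 2 * letterSize T U A κ ν y ^ 2 * ξ ^ 2 * Real.exp (ξ * letterSize T U A κ ν y)
      ≤ ξ ^ 2 * (1 / 2 * (2 * (1 + ρ ^ 2) * a) ^ 2 * Real.exp (ξ * (2 * (1 + ρ ^ 2) * a))) := by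
    rw [show 1 / 2 * letterSize T U A κ ν y ^ 2 * ξ ^ 2 * Real.exp (ξ * letterSize T U A κ ν y)
        = ξ ^ 2 * (1 / 2 * letterSize T U A κ ν y ^ 2 * Real.exp (ξ * letterSize T U A κ ν y)) by ring]
    refine mul_le_mul_of_nonneg_left ?_ (sq_nonneg ξ)
    exact mul_le_mul (by gcongr) hex (Real.exp_pos _).le (by positivity)
  have e3 : Real.exp (ξ * letterSize T U A κ ν y) * ‖(plaqU T U κ ν y : 𝔸) - 1‖
      ≤ ξ ^ 2 * (Real.exp (ξ * (2 * (1 + ρ ^ 2) * a)) * (ε / ξ ^ 2)) := by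
    rw [show ξ ^ 2 * (Real.exp (ξ * (2 * (1 + ρ ^ 2) * a)) * (ε / ξ ^ 2)) = Real.exp (ξ * (2 * (1 + ρ ^ 2) * a)) * ε by
      field_simp]
    exact mul_le_mul hex hP (norm_nonneg _) (Real.exp_pos _).le
  linarith

/-- The bond variables of `U′ = e^{iξA}U` are `ρ′`-bounded, `ρ′ = e^{ξa}ρ` (`B9Eq369Product.norm_prodCfg_le`).
[cite: Balaban1985BackgroundPropagators, (3.37) p.396] -/
theorem prodCfg_bound (hξ : 0 ≤ ξ) (hU : ∀ μ x, ‖(U μ x : 𝔸)‖ ≤ ρ ∧ ‖(((U μ x)⁻¹ : 𝔸ˣ) : 𝔸)‖ ≤ ρ)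
    (hA : ∀ μ x, ‖A μ x‖ ≤ a) (μ : ι) (x : S) :
    ‖(prodCfg U ξ A μ x : 𝔸)‖ ≤ Real.exp (ξ * a) * ρ ∧ ‖(((prodCfg U ξ A μ x)⁻¹ : 𝔸ˣ) : 𝔸)‖ ≤ Real.exp (ξ * a) * ρ :=
  norm_prodCfg_le U hξ (fun μ x => mul_le_mul_of_nonneg_left (hA μ x) hξ) hU μ x

/-- **THE PLAQUETTE FUNCTION OF `U′`**: `‖ξ⁻²π Im U′(∂p)‖ ≤ Cπ·½(1 + ρ′⁴)·Π₁`, `ρ′ = e^{ξa}ρ` (the `ξ⁻²` is absorbed by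
`‖U′(∂p) − 1‖ = O(ξ²)`). [folklore] [cite: Balaban1987RG1, (3.11) p.272] -/
theorem norm_Gπ_prodCfg_le (hξ : 0 < ξ)
    (hU : ∀ μ x, ‖(U μ x : 𝔸)‖ ≤ ρ ∧ ‖(((U μ x)⁻¹ : 𝔸ˣ) : 𝔸)‖ ≤ ρ) (hA : ∀ μ x, ‖A μ x‖ ≤ a)
    (hDA : ∀ κ ν y, ‖covD T U κ (A ν) y‖ ≤ ξ * g)
    (hCπ : 0 ≤ Cπ) (hπn : ∀ X, ‖π X‖ ≤ Cπ * ‖X‖) (κ ν : ι) (y : S) (hP : ‖(plaqU T U κ ν y : 𝔸) - 1‖ ≤ ε) :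
    ‖Gπ T π ξ (prodCfg U ξ A) κ ν y‖
      ≤ Cπ * ((1 + (Real.exp (ξ * a) * ρ) ^ 4) / 2
          * (2 * g + 1 / 2 * (2 * (1 + ρ ^ 2) * a) ^ 2 * Real.exp (ξ * (2 * (1 + ρ ^ 2) * a))
            + Real.exp (ξ * (2 * (1 + ρ ^ 2) * a)) * (ε / ξ ^ 2))) := by
  have hρ' := prodCfg_bound U hξ.le hU hA
  have hinv : ‖(((plaqU T (prodCfg U ξ A) κ ν y)⁻¹ : 𝔸ˣ) : 𝔸)‖ ≤ (Real.exp (ξ * a) * ρ) ^ 4 :=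
    norm_plaqU_inv_le T _ hρ' κ ν y
  have him := norm_imC_le hinv
  have hpl := norm_plaq_prodCfg_sub_one_le T U hξ hU hA hDA κ ν y hP
  have hr0 : 0 ≤ (1 + (Real.exp (ξ * a) * ρ) ^ 4) / 2 := by positivity
  rw [Gπ, norm_smul, norm_eta_inv_sq]
  have hξ2 : 0 < ξ ^ 2 := pow_pos hξ 2
  calc (ξ ^ 2)⁻¹ * ‖π (imC (plaqU T (prodCfg U ξ A) κ ν y))‖
      ≤ (ξ ^ 2)⁻¹ * (Cπ * ((1 + (Real.exp (ξ * a) * ρ) ^ 4) / 2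
          * (ξ ^ 2 * (2 * g + 1 / 2 * (2 * (1 + ρ ^ 2) * a) ^ 2 * Real.exp (ξ * (2 * (1 + ρ ^ 2) * a))
            + Real.exp (ξ * (2 * (1 + ρ ^ 2) * a)) * (ε / ξ ^ 2))))) := by
        refine mul_le_mul_of_nonneg_left ((hπn _).trans (mul_le_mul_of_nonneg_left (him.trans
          (mul_le_mul_of_nonneg_left hpl hr0)) hCπ)) (inv_nonneg.mpr hξ2.le)
    _ = _ := by field_simp

/-- **TERM I, one direction** (change of transport `D*_{U′} − D*_U` on the plaquette function of `U′`, [14] (1.44)–(1.45)):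
`‖(D¹*_{U′,γ}G′)(x) − (D¹*_{U,γ}G′)(x)‖ ≤ (e^{2ξρ²a} − 1)ρ²·sup‖G′‖` (`B9Eq370Expansion.norm_covDstar_prodCfg_sub_le`). [folklore]
[cite: Balaban1985RegularSpaces, (1.45) p.84] -/
theorem norm_termI_dir_le (hξ : 0 ≤ ξ) (hU : ∀ μ x, ‖(U μ x : 𝔸)‖ ≤ ρ ∧ ‖(((U μ x)⁻¹ : 𝔸ˣ) : 𝔸)‖ ≤ ρ)
    (hA : ∀ μ x, ‖A μ x‖ ≤ a) {G : S → 𝔸} {B : ℝ} (hG : ∀ z, ‖G z‖ ≤ B) (γ : ι) (x : S) :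
    ‖covDstar T (prodCfg U ξ A) γ G x - covDstar T U γ G x‖ ≤ (Real.exp (2 * (ξ * (ρ ^ 2 * a))) - 1) * (ρ ^ 2 * B) := by
  have hB : 0 ≤ B := (norm_nonneg _).trans (hG x)
  refine (norm_covDstar_prodCfg_sub_le T U hξ A γ G x).trans ?_
  have ha' : ‖R (U γ ((T γ).symm x))⁻¹ (A γ ((T γ).symm x))‖ ≤ ρ ^ 2 * a :=
    (norm_R_inv_le_rho (hU _ _).1 (hU _ _).2 _).trans (mul_le_mul_of_nonneg_left (hA _ _) (sq_nonneg ρ))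
  have hW : ‖R (U γ ((T γ).symm x))⁻¹ (G ((T γ).symm x))‖ ≤ ρ ^ 2 * B :=
    (norm_R_inv_le_rho (hU _ _).1 (hU _ _).2 _).trans (mul_le_mul_of_nonneg_left (hG _) (sq_nonneg ρ))
  have hexp : Real.exp (2 * (ξ * ‖R (U γ ((T γ).symm x))⁻¹ (A γ ((T γ).symm x))‖)) ≤ Real.exp (2 * (ξ * (ρ ^ 2 * a))) :=
    Real.exp_le_exp.mpr (by nlinarith)
  have h1 : 0 ≤ Real.exp (2 * (ξ * ‖R (U γ ((T γ).symm x))⁻¹ (A γ ((T γ).symm x))‖)) - 1 := by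
    linarith [Real.one_le_exp (show 0 ≤ 2 * (ξ * ‖R (U γ ((T γ).symm x))⁻¹ (A γ ((T γ).symm x))‖) by positivity)]
  exact mul_le_mul (by linarith) hW (norm_nonneg _) (by linarith)

omit [CompleteSpace 𝔸] in
/-- **THE SECOND-ORDER TERM, one direction** ([14] (1.51)–(1.53): «we use these factors to cancel η⁻¹»): for `π` commuting with the
transports, `‖D¹*_{U,γ}(π∘q₂)(x)‖ ≤ Cπ·ξ³(1 + ρ²)(3ρ² + 1)·s̄·g`. [folklore] [cite: Balaban1985RegularSpaces, (1.53) p.85] -/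
theorem norm_covDstar_q₂_le (hξ : 0 ≤ ξ) (hU : ∀ μ x, ‖(U μ x : 𝔸)‖ ≤ ρ ∧ ‖(((U μ x)⁻¹ : 𝔸ˣ) : 𝔸)‖ ≤ ρ)
    (hA : ∀ μ x, ‖A μ x‖ ≤ a) (hDA : ∀ κ ν y, ‖covD T U κ (A ν) y‖ ≤ ξ * g) (hCπ : 0 ≤ Cπ)
    (hπn : ∀ X, ‖π X‖ ≤ Cπ * ‖X‖) (hπR : ∀ μ x X, π (R (U μ x)⁻¹ X) = R (U μ x)⁻¹ (π X)) (γ κ ν : ι) (x : S) :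
    ‖covDstar T U γ (fun z => π (q₂ (ℓ₁ ξ A κ ν z) (ℓ₂ T U ξ A κ ν z) (ℓ₃ T U ξ A κ ν z) (ℓ₄ ξ A κ ν z))) x‖
      ≤ Cπ * (ξ ^ 3 * ((1 + ρ ^ 2) * (3 * ρ ^ 2 + 1) * (2 * (1 + ρ ^ 2) * a) * g)) := by
  set y := (T γ).symm x with hy
  have hx : x = T γ y := ((T γ).apply_symm_apply x).symm
  rw [covDstar, ← hy, ← hπR, ← map_sub]
  refine (hπn _).trans (mul_le_mul_of_nonneg_left ?_ hCπ)
  rw [hx]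
  refine (norm_R_q₂_sub_q₂_le _ _ _ _ _ _ _ _ _).trans ?_
  have hs1 := size_letters_le T U hξ hU hA κ ν (T γ y)
  have hs2 := size_R_letters_le T U hξ hU hA γ κ ν y y
  have hd := sum_norm_R_letters_sub_le T U hξ hU hDA γ κ ν y
  have hg : 0 ≤ ξ * g := (norm_nonneg _).trans (hDA κ ν y)
  have hsz0 := size_nonneg [ℓ₁ ξ A κ ν (T γ y), ℓ₂ T U ξ A κ ν (T γ y), ℓ₃ T U ξ A κ ν (T γ y), ℓ₄ ξ A κ ν (T γ y)]
  have hsz0' := size_nonneg [R (U γ y)⁻¹ (ℓ₁ ξ A κ ν y), R (U γ y)⁻¹ (ℓ₂ T U ξ A κ ν y), R (U γ y)⁻¹ (ℓ₃ T U ξ A κ ν y),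
    R (U γ y)⁻¹ (ℓ₄ ξ A κ ν y)]
  have hd0 : 0 ≤ ‖R (U γ y)⁻¹ (ℓ₁ ξ A κ ν y) - ℓ₁ ξ A κ ν (T γ y)‖ + ‖R (U γ y)⁻¹ (ℓ₂ T U ξ A κ ν y) - ℓ₂ T U ξ A κ ν (T γ y)‖
      + ‖R (U γ y)⁻¹ (ℓ₃ T U ξ A κ ν y) - ℓ₃ T U ξ A κ ν (T γ y)‖ + ‖R (U γ y)⁻¹ (ℓ₄ ξ A κ ν y) - ℓ₄ ξ A κ ν (T γ y)‖ := by
    positivity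
  calc 1 / 2 * ((size [ℓ₁ ξ A κ ν (T γ y), ℓ₂ T U ξ A κ ν (T γ y), ℓ₃ T U ξ A κ ν (T γ y), ℓ₄ ξ A κ ν (T γ y)]
        + size [R (U γ y)⁻¹ (ℓ₁ ξ A κ ν y), R (U γ y)⁻¹ (ℓ₂ T U ξ A κ ν y), R (U γ y)⁻¹ (ℓ₃ T U ξ A κ ν y),
          R (U γ y)⁻¹ (ℓ₄ ξ A κ ν y)])
        * (‖R (U γ y)⁻¹ (ℓ₁ ξ A κ ν y) - ℓ₁ ξ A κ ν (T γ y)‖ + ‖R (U γ y)⁻¹ (ℓ₂ T U ξ A κ ν y) - ℓ₂ T U ξ A κ ν (T γ y)‖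
          + ‖R (U γ y)⁻¹ (ℓ₃ T U ξ A κ ν y) - ℓ₃ T U ξ A κ ν (T γ y)‖ + ‖R (U γ y)⁻¹ (ℓ₄ ξ A κ ν y) - ℓ₄ ξ A κ ν (T γ y)‖))
      ≤ 1 / 2 * ((ξ * (2 * (1 + ρ ^ 2) * a) + ρ ^ 2 * (ξ * (2 * (1 + ρ ^ 2) * a))) * (ξ ^ 2 * ((6 * ρ ^ 2 + 2) * g))) := by
        refine mul_le_mul_of_nonneg_left (mul_le_mul (add_le_add hs1 hs2) hd hd0 ?_) (by norm_num)
        exact (add_nonneg hsz0 hsz0').trans (add_le_add hs1 hs2)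
    _ = ξ ^ 3 * ((1 + ρ ^ 2) * (3 * ρ ^ 2 + 1) * (2 * (1 + ρ ^ 2) * a) * g) := by ring

/-- **THE REMAINDER `r₃` AT A PLAQUETTE OF THE LATTICE**: `‖r₃‖ ≤ (ξs̄)³/6·e^{ξs̄} + (e^{ξs̄} − 1)e^{ξs̄}(1 + ρ⁴)ε`.
[cite: Balaban1985RegularSpaces, (1.48) p.84] -/
theorem norm_r₃_plaq_le (hξ : 0 ≤ ξ) (hU : ∀ μ x, ‖(U μ x : 𝔸)‖ ≤ ρ ∧ ‖(((U μ x)⁻¹ : 𝔸ˣ) : 𝔸)‖ ≤ ρ)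
    (hA : ∀ μ x, ‖A μ x‖ ≤ a) (κ ν : ι) (y : S) (hP : ‖(plaqU T U κ ν y : 𝔸) - 1‖ ≤ ε) :
    ‖r₃ (plaqU T U κ ν y) (ℓ₁ ξ A κ ν y) (ℓ₂ T U ξ A κ ν y) (ℓ₃ T U ξ A κ ν y) (ℓ₄ ξ A κ ν y)‖
      ≤ (ξ * (2 * (1 + ρ ^ 2) * a)) ^ 3 / 6 * Real.exp (ξ * (2 * (1 + ρ ^ 2) * a))
        + (Real.exp (ξ * (2 * (1 + ρ ^ 2) * a)) - 1) * Real.exp (ξ * (2 * (1 + ρ ^ 2) * a)) * (1 + ρ ^ 4) * ε := by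
  have h := norm_r₃_le (plaqU T U κ ν y) _ _ _ _ (size_letters_le T U hξ hU hA κ ν y) (norm_plaqU_inv_le T U hU κ ν y)
  refine h.trans (add_le_add le_rfl (mul_le_mul_of_nonneg_left hP ?_))
  have hs0 : 0 ≤ ξ * (2 * (1 + ρ ^ 2) * a) :=
    (size_nonneg _).trans (size_letters_le T U hξ hU hA κ ν y)
  have : 0 ≤ Real.exp (ξ * (2 * (1 + ρ ^ 2) * a)) - 1 := by linarith [Real.one_le_exp hs0]
  positivity

/-- … hence under `D¹*_{U,γ}` and `π`: `‖D¹*_{U,γ}(π∘r₃)(x)‖ ≤ (ρ² + 1)Cπ·[(ξs̄)³/6·e^{ξs̄} + (e^{ξs̄} − 1)e^{ξs̄}(1 + ρ⁴)ε]`.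
[cite: Balaban1985RegularSpaces, (1.44) p.84] -/
theorem norm_covDstar_r₃_le (hξ : 0 ≤ ξ) (hU : ∀ μ x, ‖(U μ x : 𝔸)‖ ≤ ρ ∧ ‖(((U μ x)⁻¹ : 𝔸ˣ) : 𝔸)‖ ≤ ρ)
    (hA : ∀ μ x, ‖A μ x‖ ≤ a) (hCπ : 0 ≤ Cπ)
    (hπn : ∀ X, ‖π X‖ ≤ Cπ * ‖X‖) (γ κ ν : ι) (x : S) (hP : ∀ y, ‖(plaqU T U κ ν y : 𝔸) - 1‖ ≤ ε) :
    ‖covDstar T U γ (fun z => π (r₃ (plaqU T U κ ν z) (ℓ₁ ξ A κ ν z) (ℓ₂ T U ξ A κ ν z) (ℓ₃ T U ξ A κ ν z) (ℓ₄ ξ A κ ν z))) x‖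
      ≤ (ρ ^ 2 + 1) * (Cπ * ((ξ * (2 * (1 + ρ ^ 2) * a)) ^ 3 / 6 * Real.exp (ξ * (2 * (1 + ρ ^ 2) * a))
        + (Real.exp (ξ * (2 * (1 + ρ ^ 2) * a)) - 1) * Real.exp (ξ * (2 * (1 + ρ ^ 2) * a)) * (1 + ρ ^ 4) * ε)) := by
  have hb : ∀ z, ‖π (r₃ (plaqU T U κ ν z) (ℓ₁ ξ A κ ν z) (ℓ₂ T U ξ A κ ν z) (ℓ₃ T U ξ A κ ν z) (ℓ₄ ξ A κ ν z))‖
      ≤ Cπ * ((ξ * (2 * (1 + ρ ^ 2) * a)) ^ 3 / 6 * Real.exp (ξ * (2 * (1 + ρ ^ 2) * a))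
        + (Real.exp (ξ * (2 * (1 + ρ ^ 2) * a)) - 1) * Real.exp (ξ * (2 * (1 + ρ ^ 2) * a)) * (1 + ρ ^ 4) * ε) :=
    fun z => (hπn _).trans (mul_le_mul_of_nonneg_left (norm_r₃_plaq_le T U hξ hU hA κ ν z (hP z)) hCπ)
  have h0 : 0 ≤ Cπ * ((ξ * (2 * (1 + ρ ^ 2) * a)) ^ 3 / 6 * Real.exp (ξ * (2 * (1 + ρ ^ 2) * a))
        + (Real.exp (ξ * (2 * (1 + ρ ^ 2) * a)) - 1) * Real.exp (ξ * (2 * (1 + ρ ^ 2) * a)) * (1 + ρ ^ 4) * ε) :=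
    (norm_nonneg _).trans (hb x)
  refine (norm_covDstar_le T U hU γ _ x).trans ?_
  nlinarith [hb ((T γ).symm x), hb x, sq_nonneg ρ]

end Terms

end Literature.MathematicalPhysics.QuantumFieldTheory.Balaban1983to89.B12Eq311LatticeBounds
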